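import Summits.ResolutionOfSingularities.ResolutionOfSingularities.Theorems.UniversalCellsCampaignW82FrobeniusTwistCalculus
import Summits.ResolutionOfSingularities.ResolutionOfSingularities.Theorems.UniversalCellsCampaignW82TwistExponentBounded
import HarnessLib

/-!
# [OURS · L1 W8.2] The BOUNDED-EXPONENT forms collapse to «AT level `e₀`»: `HasSmoothFrobeniusTwistModelLe p K f₀ e₀`
# (∃ e ≤ e₀) is «`X₀^{(p^{e₀})}` has a smooth proper birational model», by upward closure of the good levels

Cell `res-hironaka` (run/shared/lean/pub/res-hironaka/), LADDER-RESOLUTION rung L (RESCUE), slot W8.2; host route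
`UniversalCells`, host item `PrimeFieldToPerfect` (stmt-ResolutionOfSingularities-15233), door 1. Theses-free
proofs file over the OURS statement file `…TwistExponentBounded.lean` (`HasSmoothFrobeniusTwistModelLe`,
`FrobeniusTwistStepBoundedAt`, `FrobeniusTwistStepBoundedRegularAt`) and the calculus file
`…FrobeniusTwistCalculus.lean` (`smoothTwistModelAt_of_le`: the good levels are upward closed), written by
res-L1-s82-pv-1 (gen 5).

* `hasSmoothFrobeniusTwistModelLe_iff_at` — over any field `K` of characteristic `p`, `f₀` of finite type:
  «some twist of exponent `≤ e₀` has a smooth proper birational model» iff «the twist of exponent EXACTLY `e₀` has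
  one».
* `frobeniusTwistStepBoundedAt_iff_at`, `frobeniusTwistStepBoundedRegularAt_iff_at` — the slot's bounded steps
  with `∃ e ≤ e₀` replaced by the single level `e₀`.
* `frobeniusTwistStepBoundedAt_iff_regularTwistAt` — for `M` PERFECT, the bounded step at `(M, n, e₀)` in
  regularity-only form: every admissible `X₀` has a proper birational model `Y → X₀^{(p^{e₀})}` whose twist `Y^{(p)}`
  is regular (`smoothTwistModelAt_iff_regularTwistModelAt`).

HONEST FRAMING. OURS theorems about OURS statements (role replaced: §17 ¶2 p.89 l.59–62 of [Hironaka2017], typed AS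
PRINTED as `S17Methodology.U89_3`); NOT statements of the manuscript; by-name bookkeeping, not progress on the open
residual; the bounded steps are refuted for `n ≥ 1` whenever their hypothesis holds (res-L1-s82-pv-2,
`TwistExponent.*`, recorded in `…TwistExponentBounded.lean`) — this file only normalises their shape. AI work,
weaker than expert review; no claim beyond the kernel.
-/

noncomputable section

set_option linter.dupNamespace false -- mandated namespace of this single-conjunct summit

open CategoryTheory CategoryTheory.Limits AlgebraicGeometry TopologicalSpace
open Literature.AlgebraicGeometry.Resolution

namespace Summit.ResolutionOfSingularities.ResolutionOfSingularities.Theorems.CampaignW82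

/-- **«Exponent `≤ e₀`» is «exponent `e₀`»**: over any field `K` of characteristic `p`, for `f₀ : X₀ → Spec K` of
finite type, `HasSmoothFrobeniusTwistModelLe p K f₀ e₀` iff `X₀^{(p^{e₀})}` itself has a smooth proper birational
model (the good levels are upward closed, `smoothTwistModelAt_of_le`). [folklore] -/
theorem hasSmoothFrobeniusTwistModelLe_iff_at (p : ℕ) [Fact p.Prime] (K : Type) [Field K] [CharP K p]
    {X₀ : Scheme.{0}} (f₀ : X₀ ⟶ Spec (.of K)) [LocallyOfFiniteType f₀] [QuasiCompact f₀] (e₀ : ℕ) :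
    HasSmoothFrobeniusTwistModelLe p K f₀ e₀ ↔
      ∃ (Y : Scheme.{0}) (π : Y ⟶ pullback f₀ (Spec.map (CommRingCat.ofHom (iterateFrobenius K p e₀)))),
        IsProper π ∧ IsBirational π ∧
          Smooth (π ≫ pullback.snd f₀ (Spec.map (CommRingCat.ofHom (iterateFrobenius K p e₀)))) :=
  ⟨fun ⟨_, he, Y, π, h⟩ => smoothTwistModelAt_of_le p K f₀ he ⟨Y, π, h⟩, fun ⟨Y, π, h⟩ => ⟨e₀, le_rfl, Y, π, h⟩⟩

/-- **The bounded step AT level `e₀`**: `FrobeniusTwistStepBoundedAt p M n e₀` iff, under its hypothesis block, every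
admissible `X₀` has a smooth proper birational model of the twist of exponent exactly `e₀`. [folklore] -/
theorem frobeniusTwistStepBoundedAt_iff_at (p : ℕ) [Fact p.Prime] (M : Type) [Field M] [CharP M p]
    (n : WithBot ℕ∞) (e₀ : ℕ) :
    FrobeniusTwistStepBoundedAt p M n e₀ ↔
      ((∀ (X : Scheme.{0}) (f : X ⟶ Spec (.of (RatFunc M))),
          IsSeparated f → LocallyOfFiniteType f → QuasiCompact f → IsIntegral X →
            topologicalKrullDim X ≤ n → Scheme.HasResolution X) →
        ∀ (X₀ : Scheme.{0}) (f₀ : X₀ ⟶ Spec (.of (RatFunc M))),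
          IsSeparated f₀ → LocallyOfFiniteType f₀ → QuasiCompact f₀ → topologicalKrullDim X₀ ≤ n →
            IntegralOverPerfectClosure (RatFunc M) f₀ →
              ∃ (Y : Scheme.{0})
                (π : Y ⟶ pullback f₀ (Spec.map (CommRingCat.ofHom (iterateFrobenius (RatFunc M) p e₀)))),
                IsProper π ∧ IsBirational π ∧
                  Smooth (π ≫ pullback.snd f₀
                    (Spec.map (CommRingCat.ofHom (iterateFrobenius (RatFunc M) p e₀))))) := by
  refine forall_congr' fun _ => forall_congr' fun X₀ => forall_congr' fun f₀ => ?_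
  refine forall_congr' fun hs => forall_congr' fun hl => forall_congr' fun hq => forall_congr' fun _ =>
    forall_congr' fun _ => ?_
  haveI := hl; haveI := hq
  exact hasSmoothFrobeniusTwistModelLe_iff_at p (RatFunc M) f₀ e₀

/-- **The bounded step for regular varieties AT level `e₀`.** [folklore] -/
theorem frobeniusTwistStepBoundedRegularAt_iff_at (p : ℕ) [Fact p.Prime] (M : Type) [Field M] [CharP M p]
    (n : WithBot ℕ∞) (e₀ : ℕ) :
    FrobeniusTwistStepBoundedRegularAt p M n e₀ ↔
      ((∀ (X : Scheme.{0}) (f : X ⟶ Spec (.of (RatFunc M))),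
          IsSeparated f → LocallyOfFiniteType f → QuasiCompact f → IsIntegral X →
            topologicalKrullDim X ≤ n → Scheme.HasResolution X) →
        ∀ (X₀ : Scheme.{0}) (f₀ : X₀ ⟶ Spec (.of (RatFunc M))),
          IsSeparated f₀ → LocallyOfFiniteType f₀ → QuasiCompact f₀ → topologicalKrullDim X₀ ≤ n →
            IntegralOverPerfectClosure (RatFunc M) f₀ → Scheme.IsRegular X₀ →
              ∃ (Y : Scheme.{0})
                (π : Y ⟶ pullback f₀ (Spec.map (CommRingCat.ofHom (iterateFrobenius (RatFunc M) p e₀)))),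
                IsProper π ∧ IsBirational π ∧
                  Smooth (π ≫ pullback.snd f₀
                    (Spec.map (CommRingCat.ofHom (iterateFrobenius (RatFunc M) p e₀))))) := by
  refine forall_congr' fun _ => forall_congr' fun X₀ => forall_congr' fun f₀ => ?_
  refine forall_congr' fun hs => forall_congr' fun hl => forall_congr' fun hq => forall_congr' fun _ =>
    forall_congr' fun _ => forall_congr' fun _ => ?_
  haveI := hl; haveI := hq
  exact hasSmoothFrobeniusTwistModelLe_iff_at p (RatFunc M) f₀ e₀

/-- **The bounded step at `(M, n, e₀)` for PERFECT `M`, in regularity-only form**: under its hypothesis block, every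
admissible `X₀` has a proper birational model `Y → X₀^{(p^{e₀})}` whose Frobenius twist `Y^{(p)}` is REGULAR.
[cite: EGAIV2, Prop. 6.7.4] -/
theorem frobeniusTwistStepBoundedAt_iff_regularTwistAt (p : ℕ) [Fact p.Prime] (M : Type) [Field M] [CharP M p]
    [PerfectField M] (n : WithBot ℕ∞) (e₀ : ℕ) :
    FrobeniusTwistStepBoundedAt p M n e₀ ↔
      ((∀ (X : Scheme.{0}) (f : X ⟶ Spec (.of (RatFunc M))),
          IsSeparated f → LocallyOfFiniteType f → QuasiCompact f → IsIntegral X →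
            topologicalKrullDim X ≤ n → Scheme.HasResolution X) →
        ∀ (X₀ : Scheme.{0}) (f₀ : X₀ ⟶ Spec (.of (RatFunc M))),
          IsSeparated f₀ → LocallyOfFiniteType f₀ → QuasiCompact f₀ → topologicalKrullDim X₀ ≤ n →
            IntegralOverPerfectClosure (RatFunc M) f₀ →
              ∃ (Y : Scheme.{0})
                (π : Y ⟶ pullback f₀ (Spec.map (CommRingCat.ofHom (iterateFrobenius (RatFunc M) p e₀)))),
                IsProper π ∧ IsBirational π ∧
                  Scheme.IsRegular (pullback
                    (π ≫ pullback.snd f₀ (Spec.map (CommRingCat.ofHom (iterateFrobenius (RatFunc M) p e₀))))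
                    (Spec.map (CommRingCat.ofHom (frobenius (RatFunc M) p))))) := by
  rw [frobeniusTwistStepBoundedAt_iff_at]
  refine forall_congr' fun _ => forall_congr' fun X₀ => forall_congr' fun f₀ => ?_
  refine forall_congr' fun hs => forall_congr' fun hl => forall_congr' fun hq => forall_congr' fun _ =>
    forall_congr' fun _ => ?_
  haveI := hl; haveI := hq
  exact smoothTwistModelAt_iff_regularTwistModelAt p M f₀ e₀

end Summit.ResolutionOfSingularities.ResolutionOfSingularities.Theorems.CampaignW82

end
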